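import Summits.QuantumFields.YangMills.Theorems.BalabanUVNodesN16SchemeMinActInvariance
import HarnessLib

/-!
# YM-DAG node N16 (NE3), the located averaging pin (42) ↔ (0.4) — part 27: THE APPROXIMATE TRANSFER PRINCIPLE (I) — N16's END numbers `A_k(V) = inf A^{(k)}`
# under a change of averaging scheme that is only δ-CLOSE UP TO GAUGE, given ONE located analytic input: a LOCAL RIGHT INVERSE of the target constraint WITH
# ACTION MODULUS

Cell `pub-ymgap`, width seat `pub-ymgap-dag-n16-w3` (director-ym №197 ∕ HUMAN RULING D-0149), generation 9; part 27 of the W1b lineage (index: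
`HOME/pub-ymgap-dag-n16-w3/MODULE-INDEX.md`; part 14 p616704 `SchemeGaugeEquiv`, part 17 p624987 `…N16SchemeMinActInvariance`: EXACT scheme-class invariance of
the END numbers; parts 22∕25∕26 p630593∕p636850∕p638947: the scheme OF RECORD (0.4) is a coarse gauge transform of (42) only UP TO SECOND ORDER `O(ρ₂)` per step).
`--supports stmt-QuantumFields-27366 --as helper` (K3⁸, KEY MAP v2; count-neutral).  `bears_on: R4∕N16`.  Part 28 (`…N16ApproximateSchemeTransferEnd`) carries the
consequence for N16's ACTION-RATE END `T4EtaRateMin.ActionRate` ∕ `NE3Shape`.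

THE POINT.  Part 17 transfers N16's END numbers between two averaging schemes whose `k`-fold averages agree EXACTLY up to a unitary periodic coarse gauge on the
class (part 14's `SchemeGaugeEquiv`): the admissible action value sets coincide.  For the pin (42) ↔ (0.4) this hypothesis is FALSE as typed (part 23's centre witness)
and false numerically at third order on `SU(2)` fields (g8 `W3-PIN-ANATOMY-v6.md` §2); what parts 22∕25∕26 DO give is closeness up to gauge to second order.  This file
says what closeness up to gauge buys, and isolates the ONE analytic input that turns it into a statement about END numbers:
 * §1 `CfgNear δ A B` — bondwise operator-norm closeness `‖A(x,i) − B(x,i)‖ ≤ δ`; `δ = 0` iff `A = B`; INVARIANT under unitary site gauges (`cfgNear_gaugeAct_iff`).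
 * §2 `ApproxSchemeGaugeEquiv d s₁ s₂ L N k C δ` — part 14's criterion with its (defect) clause relaxed to «the two `k`-fold averages of every `U ∈ C` are δ-close
   up to a unitary `N`-periodic coarse gauge `κ_U`» (block-lift covariance kept exact); `δ = 0` IS part 14's criterion (`approx_zero_iff`); symmetric (`κ_U⁻¹`),
   transitive with `δ₁ + δ₂` (gauges multiply), monotone, restricts to sub-classes.
 * §3 `RightInverseModulus d s 𝒞 L N k D δ ω` — THE LOCATED ANALYTIC INPUT (a hypothesis SHAPE, asserted for nothing): every class member `U ∈ 𝒞 k` whose `k`-fold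
   `s`-average is δ-close to a datum `V ∈ D` is CORRECTED inside the class to an `s`-admissible configuration of datum EXACTLY `V` at level-`k` action cost `≤ ω`.
   In print the construction of configurations with PRESCRIBED averages near a given one is [Balaban1985Variational] (44)–(47) p. 285 (a right inverse `H` of the
   linearised averaging with the (46) letters; chart `A = A′ − H D(A′)`); the tree holds the LINEARISED flat-background `H` (dag-k0-s1-w1
   `…K0Stub1RecordAveragingRightInverse`, dag-n07 `…N07MultiScaleLiftsRightInverse`), no nonlinear local section with an action modulus.  Free at `δ = 0` (`U′ = U`).
 * §4 ★★ THE TRANSFER: on a class invariant under unitary `(N·L^k)`-periodic gauges, (H1) `ApproxSchemeGaugeEquiv d s₁ s₂ L N k (𝒞 k) δ` + (H2) `RightInverseModulus d s₂ 𝒞 L N k D δ ω`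
   ⇒ every `s₁`-admissible `U` at a datum `V ∈ D` has an `s₂`-admissible COMPETITOR `U′` AT THE SAME DATUM with `A^{(k)}(U′) ≤ A^{(k)}(U) + ω` (`exists_admissibleS_le_add`:
   the gauge transform `U^{lift κ_U⁻¹}` has `s₂`-average δ-close to `V` itself — (cov₂) and §1's gauge invariance — and the same action, `levelAction_gaugeAct`; (H2) corrects
   it).  Hence admissibility transfers; an `s₂`-minimiser costs at most `ω` more than any `s₁`-admissible configuration (`levelAction_isMinimiserS_le_add`) and, with (H2) for
   BOTH schemes, ★★ `|A^{(k)}(U₁) − A^{(k)}(U₂)| ≤ ω` for minimisers of the two problems at the same datum; inf forms `sInf_levelAction_admissibleS_le_add` ∕ ★★ `abs_sInf_sub_sInf_le`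
   (bounded below on `U(N)`-valued classes, `levelAction_nonneg`); against (43) ★★ `abs_sInf_admissibleS_sub_minAct_le`: `|inf A^{(k)}(admissibleS s 𝒞 k V) − minAct d 𝒞 L N k V| ≤ ω`.
   CONSISTENCY: at `δ = 0` (H2) is free with `ω = 0` and §4 re-derives part 17's equality of the infima (`sInf_levelAction_admissibleS_eq_of_schemeGaugeEquiv'`, under
   admissibility + a class lower bound; part 17's own `sInf_levelAction_admissibleS_eq` needs neither).
READING (honest; for the planners, D-0014, nothing re-cut or filed as an item).  THE (42) → (0.4) PIN FOR N16's END NUMBERS = (H1) + (H2); (H1) for `(step42, step04)` at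
depth `k` is NOT proved anywhere (parts 22∕25∕26: PER-STEP second order in a local exponential gauge on the guard; per-step ⇒ `k`-fold needs Lipschitz control of the
averaging along the orbit — a later part); (H2) is analysis ([Balaban1985Variational] (44)–(47) road), crux-sized, not bookkeeping.

HONEST FRAMING.  [folklore] bookkeeping BY NAME over parts 0a∕12∕14∕17 and pub-balaban's `MinimalActionSandwich.minAct` ∕ `NE7EtaMinimiserGaugeCovariance.levelAction_gaugeAct`
∕ `MinimalActionLevels.levelAction_nonneg`; three Prop-valued declarations (`CfgNear` — a distance reading; `ApproxSchemeGaugeEquiv`, `RightInverseModulus` — hypothesis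
SHAPES asserted for NO scheme, class or datum); 0 `sorry`, no `instance`, no `notation`; no minimiser constructed (minimisers appear only as displayed hypotheses); NO
estimate proved; nothing of [Balaban1985Variational] ∕ [Balaban1987RG1] asserted; K3⁸ stubs `stub_rates13HV` ∕ `stub_expansion13HV` NOT touched; N16 ∕ NE3 NOT discharged;
count-neutral (typed 28∕28 · discharged 5∕27 work-bound, A 5∕28 — unmoved).  One finite four-torus programme at fixed `ε` — the Yang–Mills mass gap (Clay) is NOT proved
by any of this; R4 closes the conditional finite-𝕋⁴ rung `BalabanLadder.UV` only; nothing continuum ∕ ℝ⁴ ∕ OS.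
-/


set_option autoImplicit false

open scoped BigOperators Matrix Matrix.Norms.L2Operator
open NormedSpace

namespace Summit.QuantumFields.YangMills.BalabanUVNodes.N16ApproximateSchemeTransfer

open Literature.MathematicalPhysics.QuantumFieldTheory.Balaban1983to89
open B7Prop1Explicit B7Prop2Explicit
open Summit.QuantumFields.BalabanUV.T4Continuum
open MinimalActionLevels (levelAction levelAction_nonneg)
open MinimalActionSandwich (admissible minAct IsMinimiser)
open NE3EnergyShapes (IsUnitarySite IsPeriodicSite)
open T4AveragingDeficitWall (IsUnitaryCfg)
open AveragingDeficitKDatum (gaugeAct_inv_gaugeAct)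
open NE7EtaMinimiserGaugeCovariance (levelAction_gaugeAct isUnitarySite_inv isPeriodicSite_inv)
open Summit.QuantumFields.YangMills.BalabanUVNodes.N16AveragingPin
  (avgIterS step42 avgIterS_step42 admissibleS mem_admissibleS_iff admissibleS_step42 IsMinimiserS)
open Summit.QuantumFields.YangMills.BalabanUVNodes.N16AveragingTransferOfGaugeDefect (isUnitarySite_blockLift isPeriodicSite_blockLift)
open Summit.QuantumFields.YangMills.BalabanUVNodes.N16CentreConventionTransfer (SchemeGaugeEquiv gaugeAct_gaugeAct)

noncomputable section

variable {d : ℕ} {n : Type*} [Fintype n] [DecidableEq n]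

/-! ## §1 Bondwise closeness of configurations and its gauge invariance -/

section Near

/-- **BONDWISE CLOSENESS**: `CfgNear δ A B` — at every bond the two bond variables are within `δ` in operator norm, `‖A(x,i) − B(x,i)‖ ≤ δ`.  A distance
READING (the sup over bonds, written as a `∀`); asserted for nothing. [folklore] -/
@[folklore]
def CfgNear (δ : ℝ) (A B : Site d → Fin d → (Matrix n n ℂ)ˣ) : Prop :=
  ∀ (x : Site d) (i : Fin d), ‖((A x i : (Matrix n n ℂ)ˣ) : Matrix n n ℂ) - ((B x i : (Matrix n n ℂ)ˣ) : Matrix n n ℂ)‖ ≤ δ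

variable {δ δ' δ₁ δ₂ : ℝ} {A B C : Site d → Fin d → (Matrix n n ℂ)ˣ}

/-- Reflexive at every `δ ≥ 0`. [folklore] -/
theorem cfgNear_refl (hδ : 0 ≤ δ) (A : Site d → Fin d → (Matrix n n ℂ)ˣ) : CfgNear δ A A :=
  fun x i => by rw [sub_self, norm_zero]; exact hδ

/-- Symmetric. [folklore] -/
theorem CfgNear.symm (h : CfgNear δ A B) : CfgNear δ B A :=
  fun x i => by rw [norm_sub_rev]; exact h x i

/-- Monotone in the radius. [folklore] -/
theorem CfgNear.mono (h : CfgNear δ A B) (hδ : δ ≤ δ') : CfgNear δ' A B :=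
  fun x i => (h x i).trans hδ

/-- Triangle inequality: radii add. [folklore] -/
theorem CfgNear.triangle (h₁ : CfgNear δ₁ A B) (h₂ : CfgNear δ₂ B C) : CfgNear (δ₁ + δ₂) A C :=
  fun x i => (norm_sub_le_norm_sub_add_norm_sub _ _ _).trans (add_le_add (h₁ x i) (h₂ x i))

/-- The radius of a witnessed closeness is non-negative as soon as there is a bond (`0 < d`). [folklore] -/
theorem CfgNear.nonneg (h : CfgNear δ A B) (hd : 0 < d) : 0 ≤ δ :=
  (norm_nonneg _).trans (h 0 ⟨0, hd⟩)

/-- **`δ = 0` IS EQUALITY**: two configurations are `0`-close iff they are equal (bond variables are units of `M_n(ℂ)`, `Units.ext`). [folklore] -/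
theorem cfgNear_zero_iff : CfgNear 0 A B ↔ A = B := by
  constructor
  · intro h
    funext x i
    exact Units.ext (sub_eq_zero.mp (norm_le_zero_iff.mp (h x i)))
  · rintro rfl
    exact cfgNear_refl le_rfl A

/-- `0`-close configurations are equal. [folklore] -/
theorem CfgNear.eq_of_zero (h : CfgNear 0 A B) : A = B :=
  cfgNear_zero_iff.mp h

/-- **UNITARY SITE GAUGES ARE BONDWISE ISOMETRIES**: `‖A^u(x,i) − B^u(x,i)‖ = ‖A(x,i) − B(x,i)‖` for a unitary site field `u`
(`A^u(x,i) − B^u(x,i) = u(x)·(A(x,i) − B(x,i))·u(x+e_i)⁻¹`; the operator norm is unitarily invariant, `CStarRing.norm_mem_unitary_mul` ∕ `norm_mul_mem_unitary`). [folklore] -/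
theorem norm_gaugeAct_sub_gaugeAct {u : Site d → (Matrix n n ℂ)ˣ} (hu : IsUnitarySite u) (A B : Site d → Fin d → (Matrix n n ℂ)ˣ)
    (x : Site d) (i : Fin d) :
    ‖((gaugeAct u A x i : (Matrix n n ℂ)ˣ) : Matrix n n ℂ) - ((gaugeAct u B x i : (Matrix n n ℂ)ˣ) : Matrix n n ℂ)‖
      = ‖((A x i : (Matrix n n ℂ)ˣ) : Matrix n n ℂ) - ((B x i : (Matrix n n ℂ)ˣ) : Matrix n n ℂ)‖ := by
  have e : ((gaugeAct u A x i : (Matrix n n ℂ)ˣ) : Matrix n n ℂ) - ((gaugeAct u B x i : (Matrix n n ℂ)ˣ) : Matrix n n ℂ)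
      = ((u x : (Matrix n n ℂ)ˣ) : Matrix n n ℂ) * (((A x i : (Matrix n n ℂ)ˣ) : Matrix n n ℂ) - ((B x i : (Matrix n n ℂ)ˣ) : Matrix n n ℂ))
          * (((u (x + e i))⁻¹ : (Matrix n n ℂ)ˣ) : Matrix n n ℂ) := by
    simp only [gaugeAct, Units.val_mul, mul_sub, sub_mul]
  rw [e, CStarRing.norm_mul_mem_unitary _ (mem_unitaryUnits.mp ((unitaryUnits _).inv_mem (hu _))),
    CStarRing.norm_mem_unitary_mul _ (mem_unitaryUnits.mp (hu x))]

/-- Closeness is preserved by unitary site gauges. [folklore] -/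
theorem CfgNear.gaugeAct {u : Site d → (Matrix n n ℂ)ˣ} (hu : IsUnitarySite u) (h : CfgNear δ A B) :
    CfgNear δ (gaugeAct u A) (gaugeAct u B) :=
  fun x i => by rw [norm_gaugeAct_sub_gaugeAct hu]; exact h x i

/-- … and reflected by them (`Iff`). [folklore] -/
theorem cfgNear_gaugeAct_iff {u : Site d → (Matrix n n ℂ)ˣ} (hu : IsUnitarySite u) :
    CfgNear δ (gaugeAct u A) (gaugeAct u B) ↔ CfgNear δ A B :=
  ⟨fun h x i => by rw [← norm_gaugeAct_sub_gaugeAct hu]; exact h x i, fun h => h.gaugeAct hu⟩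

end Near

/-! ## §2 Approximate coarse-gauge equivalence of two averaging schemes on a class -/

section Approx

variable (d) in
/-- **APPROXIMATE COARSE-GAUGE EQUIVALENCE OF TWO SCHEMES AT DEPTH `k` ON A CLASS `C`, DEFECT `δ`**: part 14's `SchemeGaugeEquiv` with the (defect) clause RELAXED —
(cov₁)∕(cov₂) block lifts of unitary `N`-periodic coarse gauges move the two `k`-fold averages covariantly (exact, as there), and (defect) for every `U ∈ C` there is a
unitary `N`-periodic coarse gauge `κ_U` with the `s₂`-average of `U` BONDWISE `δ`-CLOSE to the `κ_U`-transform of its `s₁`-average.  A hypothesis SHAPE, asserted for no pair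
of schemes; at `δ = 0` it IS part 14's criterion (`approx_zero_iff`). [folklore] -/
@[folklore]
structure ApproxSchemeGaugeEquiv (s₁ s₂ : ℕ → (Site d → Fin d → (Matrix n n ℂ)ˣ) → (Site d → Fin d → (Matrix n n ℂ)ˣ)) (L N k : ℕ)
    (C : Set (Site d → Fin d → (Matrix n n ℂ)ˣ)) (δ : ℝ) : Prop where
  /-- (cov₁) block lifts move `s₁`'s `k`-fold average by `κ` -/
  cov₁ : ∀ (κ : Site d → (Matrix n n ℂ)ˣ) (U : Site d → Fin d → (Matrix n n ℂ)ˣ), IsUnitarySite κ → IsPeriodicSite κ (N : ℤ) → U ∈ C →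
    avgIterS s₁ k (gaugeAct (fun x : Site d => κ (fun i => x i / (L : ℤ) ^ k)) U) = gaugeAct κ (avgIterS s₁ k U)
  /-- (cov₂) block lifts move `s₂`'s `k`-fold average by `κ` -/
  cov₂ : ∀ (κ : Site d → (Matrix n n ℂ)ˣ) (U : Site d → Fin d → (Matrix n n ℂ)ˣ), IsUnitarySite κ → IsPeriodicSite κ (N : ℤ) → U ∈ C →
    avgIterS s₂ k (gaugeAct (fun x : Site d => κ (fun i => x i / (L : ℤ) ^ k)) U) = gaugeAct κ (avgIterS s₂ k U)
  /-- (defect) on `C` the two `k`-fold averages are `δ`-close up to a unitary `N`-periodic coarse gauge -/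
  defect : ∀ U ∈ C, ∃ κ : Site d → (Matrix n n ℂ)ˣ, IsUnitarySite κ ∧ IsPeriodicSite κ (N : ℤ) ∧
    CfgNear δ (avgIterS s₂ k U) (gaugeAct κ (avgIterS s₁ k U))

variable {s₁ s₂ s₃ : ℕ → (Site d → Fin d → (Matrix n n ℂ)ˣ) → (Site d → Fin d → (Matrix n n ℂ)ˣ)} {L N k : ℕ}
  {C C' : Set (Site d → Fin d → (Matrix n n ℂ)ˣ)} {δ δ' δ₁ δ₂ : ℝ}

/-- **PART 14's CRITERION IS THE CASE OF EVERY `δ ≥ 0`**: exact coarse-gauge equivalence gives approximate equivalence with any non-negative defect (`approx_of_schemeGaugeEquiv`). [folklore] -/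
theorem approx_of_schemeGaugeEquiv (h : SchemeGaugeEquiv d s₁ s₂ L N k C) (hδ : 0 ≤ δ) : ApproxSchemeGaugeEquiv d s₁ s₂ L N k C δ where
  cov₁ := h.cov₁
  cov₂ := h.cov₂
  defect U hU := by
    obtain ⟨κ, hκ, hκP, hdef⟩ := h.defect U hU
    exact ⟨κ, hκ, hκP, by rw [hdef]; exact cfgNear_refl hδ _⟩

/-- **`δ = 0` ⟺ PART 14's CRITERION** (`cfgNear_zero_iff`). [folklore] -/
theorem approx_zero_iff : ApproxSchemeGaugeEquiv d s₁ s₂ L N k C 0 ↔ SchemeGaugeEquiv d s₁ s₂ L N k C := by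
  constructor
  · intro h
    exact
      { cov₁ := h.cov₁
        cov₂ := h.cov₂
        defect := fun U hU => by
          obtain ⟨κ, hκ, hκP, hdef⟩ := h.defect U hU
          exact ⟨κ, hκ, hκP, hdef.eq_of_zero⟩ }
  · intro h
    exact approx_of_schemeGaugeEquiv h le_rfl

/-- Monotone in the defect. [folklore] -/
theorem ApproxSchemeGaugeEquiv.mono (h : ApproxSchemeGaugeEquiv d s₁ s₂ L N k C δ) (hδ : δ ≤ δ') : ApproxSchemeGaugeEquiv d s₁ s₂ L N k C δ' where
  cov₁ := h.cov₁
  cov₂ := h.cov₂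
  defect U hU := by
    obtain ⟨κ, hκ, hκP, hdef⟩ := h.defect U hU
    exact ⟨κ, hκ, hκP, hdef.mono hδ⟩

/-- Restricts to sub-classes. [folklore] -/
theorem ApproxSchemeGaugeEquiv.of_subset (h : ApproxSchemeGaugeEquiv d s₁ s₂ L N k C δ) (hC' : C' ⊆ C) : ApproxSchemeGaugeEquiv d s₁ s₂ L N k C' δ where
  cov₁ κ U hκ hκP hU := h.cov₁ κ U hκ hκP (hC' hU)
  cov₂ κ U hκ hκP hU := h.cov₂ κ U hκ hκP (hC' hU)
  defect U hU := h.defect U (hC' hU)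

/-- **SYMMETRIC** with the same defect: the inverse gauge `κ_U⁻¹` (§1's gauge invariance of closeness + `gaugeAct_inv_gaugeAct`). [folklore] -/
theorem ApproxSchemeGaugeEquiv.symm (h : ApproxSchemeGaugeEquiv d s₁ s₂ L N k C δ) : ApproxSchemeGaugeEquiv d s₂ s₁ L N k C δ where
  cov₁ := h.cov₂
  cov₂ := h.cov₁
  defect U hU := by
    obtain ⟨κ, hκ, hκP, hdef⟩ := h.defect U hU
    refine ⟨fun w => (κ w)⁻¹, isUnitarySite_inv hκ, isPeriodicSite_inv hκP, ?_⟩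
    have h' := hdef.gaugeAct (isUnitarySite_inv hκ)
    rw [gaugeAct_inv_gaugeAct] at h'
    exact h'.symm

/-- **TRANSITIVE, DEFECTS ADD**: the data-dependent gauges multiply (`gaugeAct_gaugeAct`, as in part 17 `schemeGaugeEquiv_trans`) and the radii add (§1 triangle after
transporting the first closeness by the second gauge). [folklore] -/
theorem ApproxSchemeGaugeEquiv.trans (h₁₂ : ApproxSchemeGaugeEquiv d s₁ s₂ L N k C δ₁) (h₂₃ : ApproxSchemeGaugeEquiv d s₂ s₃ L N k C δ₂) :
    ApproxSchemeGaugeEquiv d s₁ s₃ L N k C (δ₁ + δ₂) where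
  cov₁ := h₁₂.cov₁
  cov₂ := h₂₃.cov₂
  defect U hU := by
    obtain ⟨κ, hκ, hκP, h⟩ := h₁₂.defect U hU
    obtain ⟨κ', hκ', hκ'P, h'⟩ := h₂₃.defect U hU
    refine ⟨fun z => κ' z * κ z, fun z => (unitaryUnits (Matrix n n ℂ)).mul_mem (hκ' z) (hκ z), fun z i => ?_, ?_⟩
    · show κ' (z + (N : ℤ) • e i) * κ (z + (N : ℤ) • e i) = κ' z * κ z
      rw [hκ'P z i, hκP z i]
    · have h'' : CfgNear δ₁ (gaugeAct κ' (avgIterS s₂ k U)) (gaugeAct (fun z => κ' z * κ z) (avgIterS s₁ k U)) := by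
        rw [← gaugeAct_gaugeAct]
        exact h.gaugeAct hκ'
      have := h'.triangle h''
      rwa [add_comm] at this

end Approx

/-! ## §3 THE LOCATED ANALYTIC INPUT: a local right inverse of the constraint with action modulus -/

section RightInverse

variable (d) in
/-- **LOCAL RIGHT INVERSE OF THE `s`-CONSTRAINT AT DEPTH `k` WITH ACTION MODULUS** — `RightInverseModulus d s 𝒞 L N k D δ ω`: for every datum `V ∈ D` and every class
member `U ∈ 𝒞 k` whose `k`-fold `s`-average is bondwise `δ`-close to `V`, there is an `s`-ADMISSIBLE configuration `U′` of datum EXACTLY `V` (in the class) with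
`A^{(k)}(U′) ≤ A^{(k)}(U) + ω`.  THE analytic input of the approximate transfer; in print the construction of configurations with prescribed averages near a given one is
[Balaban1985Variational] (44)–(47) p. 285 (right inverse `H` of the linearised averaging with the (46) letters; chart `A = A′ − H D(A′)`) — located here as a HYPOTHESIS
SHAPE, asserted for NO scheme, class, depth or datum; free at `δ = 0` (`rightInverseModulus_zero`). [folklore] -/
@[folklore]
def RightInverseModulus (s : ℕ → (Site d → Fin d → (Matrix n n ℂ)ˣ) → (Site d → Fin d → (Matrix n n ℂ)ˣ))
    (𝒞 : ℕ → Set (Site d → Fin d → (Matrix n n ℂ)ˣ)) (L N k : ℕ) (D : Set (Site d → Fin d → (Matrix n n ℂ)ˣ)) (δ ω : ℝ) : Prop :=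
  ∀ V ∈ D, ∀ U ∈ 𝒞 k, CfgNear δ (avgIterS s k U) V →
    ∃ U' ∈ admissibleS s 𝒞 k V, levelAction d L N k U' ≤ levelAction d L N k U + ω

variable {s : ℕ → (Site d → Fin d → (Matrix n n ℂ)ˣ) → (Site d → Fin d → (Matrix n n ℂ)ˣ)}
  {𝒞 : ℕ → Set (Site d → Fin d → (Matrix n n ℂ)ˣ)} {L N k : ℕ} {D D' : Set (Site d → Fin d → (Matrix n n ℂ)ˣ)} {δ δ' ω ω' : ℝ}

/-- **FREE AT `δ = 0`**: a `0`-close average IS the datum, so `U′ = U` corrects at no cost (any `ω ≥ 0`). [folklore] -/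
theorem rightInverseModulus_zero (hω : 0 ≤ ω) : RightInverseModulus d s 𝒞 L N k D 0 ω :=
  fun _ _ U hU hnear => ⟨U, ⟨hU, hnear.eq_of_zero⟩, le_add_of_nonneg_right hω⟩

/-- Monotone: a smaller closeness radius and a larger cost are implied. [folklore] -/
theorem RightInverseModulus.mono (h : RightInverseModulus d s 𝒞 L N k D δ ω) (hδ : δ' ≤ δ) (hω : ω ≤ ω') :
    RightInverseModulus d s 𝒞 L N k D δ' ω' := by
  intro V hV U hU hnear
  obtain ⟨U', hU', hle⟩ := h V hV U hU (hnear.mono hδ)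
  exact ⟨U', hU', hle.trans (by linarith)⟩

/-- Restricts to fewer data. [folklore] -/
theorem RightInverseModulus.of_subset (h : RightInverseModulus d s 𝒞 L N k D δ ω) (hD' : D' ⊆ D) :
    RightInverseModulus d s 𝒞 L N k D' δ ω :=
  fun V hV => h V (hD' hV)

end RightInverse

/-! ## §4 THE APPROXIMATE TRANSFER of admissibility, minimisers' actions and minimal actions -/

section Transfer

variable {s s₁ s₂ : ℕ → (Site d → Fin d → (Matrix n n ℂ)ˣ) → (Site d → Fin d → (Matrix n n ℂ)ˣ)}
  {𝒞 : ℕ → Set (Site d → Fin d → (Matrix n n ℂ)ˣ)} {L N k : ℕ} {D : Set (Site d → Fin d → (Matrix n n ℂ)ˣ)} {δ ω : ℝ}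

/-- On a `U(N)`-valued set the level action is bounded below (by `0`, `levelAction_nonneg`) — the `BddBelow` input of the inf forms below. [folklore] -/
theorem bddBelow_levelAction_image_of_isUnitaryCfg [Nonempty n] (hL : 1 ≤ L) {S : Set (Site d → Fin d → (Matrix n n ℂ)ˣ)}
    (hS : ∀ U ∈ S, IsUnitaryCfg U) : BddBelow (levelAction d L N k '' S) := by
  refine ⟨0, ?_⟩
  rintro _ ⟨U, hU, rfl⟩
  exact levelAction_nonneg L N k hL (hS U hU)

/-- The admissible sets are parts of the class, so a class lower bound bounds their action images below. [folklore] -/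
theorem bddBelow_levelAction_image_admissibleS (hB : BddBelow (levelAction d L N k '' 𝒞 k)) (V : Site d → Fin d → (Matrix n n ℂ)ˣ) :
    BddBelow (levelAction d L N k '' admissibleS s 𝒞 k V) :=
  hB.mono (Set.image_mono fun _ hU => hU.1)

/-! The standing hypotheses of the transfer: `1 ≤ L` and the class `𝒞 k` is invariant under unitary `(N·L^k)`-periodic gauges (as in parts 14∕17). -/
variable (hL : 1 ≤ L)
  (hC : ∀ (u : Site d → (Matrix n n ℂ)ˣ) (U : Site d → Fin d → (Matrix n n ℂ)ˣ), IsUnitarySite u →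
    IsPeriodicSite u ((N * L ^ k : ℕ) : ℤ) → U ∈ 𝒞 k → gaugeAct u U ∈ 𝒞 k)
include hL hC

/-- **★★ THE COMPETITOR**: on a class invariant under unitary `(N·L^k)`-periodic gauges, under (H1) `ApproxSchemeGaugeEquiv d s₁ s₂ L N k (𝒞 k) δ` and (H2)
`RightInverseModulus d s₂ 𝒞 L N k D δ ω`, every `s₁`-admissible `U` at a datum `V ∈ D` has an `s₂`-admissible `U′` AT THE SAME DATUM with `A^{(k)}(U′) ≤ A^{(k)}(U) + ω`.
Mechanism: the gauge transform `U^{lift κ_U⁻¹}` lies in the class, has the same action (`levelAction_gaugeAct`) and — by (cov₂), §1's gauge invariance and `avgIterS s₁ k U = V` —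
its `s₂`-average is `δ`-close to `V` itself; (H2) corrects it to datum `V`. [folklore] -/
theorem exists_admissibleS_le_add (hE : ApproxSchemeGaugeEquiv d s₁ s₂ L N k (𝒞 k) δ) (hR : RightInverseModulus d s₂ 𝒞 L N k D δ ω)
    {V : Site d → Fin d → (Matrix n n ℂ)ˣ} (hV : V ∈ D) {U : Site d → Fin d → (Matrix n n ℂ)ˣ} (hU : U ∈ admissibleS s₁ 𝒞 k V) :
    ∃ U' ∈ admissibleS s₂ 𝒞 k V, levelAction d L N k U' ≤ levelAction d L N k U + ω := by
  obtain ⟨hUC, hUV⟩ := hU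
  obtain ⟨κ, hκ, hκP, hnear⟩ := hE.defect U hUC
  have hκi : IsUnitarySite (fun z => (κ z)⁻¹) := isUnitarySite_inv hκ
  have hκiP : IsPeriodicSite (fun z => (κ z)⁻¹) (N : ℤ) := isPeriodicSite_inv hκP
  have hU₁C : gaugeAct (fun x : Site d => (κ (fun i => x i / (L : ℤ) ^ k))⁻¹) U ∈ 𝒞 k :=
    hC _ U (isUnitarySite_blockLift hκi _) (isPeriodicSite_blockLift L hL k hκiP) hUC
  have havg : avgIterS s₂ k (gaugeAct (fun x : Site d => (κ (fun i => x i / (L : ℤ) ^ k))⁻¹) U)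
      = gaugeAct (fun z => (κ z)⁻¹) (avgIterS s₂ k U) := hE.cov₂ (fun z => (κ z)⁻¹) U hκi hκiP hUC
  have hnear' : CfgNear δ (avgIterS s₂ k (gaugeAct (fun x : Site d => (κ (fun i => x i / (L : ℤ) ^ k))⁻¹) U)) V := by
    rw [havg]
    have h' := hnear.gaugeAct hκi
    rwa [hUV, gaugeAct_inv_gaugeAct] at h'
  obtain ⟨U', hU', hle⟩ := hR V hV _ hU₁C hnear'
  exact ⟨U', hU', by rwa [levelAction_gaugeAct] at hle⟩

/-- **ADMISSIBILITY TRANSFERS**: under (H1)+(H2) an `s₁`-admissible datum of `D` is `s₂`-admissible. [folklore] -/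
theorem nonempty_admissibleS_of_approx (hE : ApproxSchemeGaugeEquiv d s₁ s₂ L N k (𝒞 k) δ) (hR : RightInverseModulus d s₂ 𝒞 L N k D δ ω)
    {V : Site d → Fin d → (Matrix n n ℂ)ˣ} (hV : V ∈ D) (hne : (admissibleS s₁ 𝒞 k V).Nonempty) : (admissibleS s₂ 𝒞 k V).Nonempty := by
  obtain ⟨U, hU⟩ := hne
  obtain ⟨U', hU', -⟩ := exists_admissibleS_le_add hL hC hE hR hV hU
  exact ⟨U', hU'⟩

/-- **★ MINIMISER FORM, ONE SIDE**: an `s₂`-minimiser at `V` costs at most `ω` more than any `s₁`-admissible configuration at `V` (a fortiori than an `s₁`-minimiser). [folklore] -/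
theorem levelAction_isMinimiserS_le_add (hE : ApproxSchemeGaugeEquiv d s₁ s₂ L N k (𝒞 k) δ) (hR : RightInverseModulus d s₂ 𝒞 L N k D δ ω)
    {V U₁ U₂ : Site d → Fin d → (Matrix n n ℂ)ˣ} (hV : V ∈ D) (hU₁ : U₁ ∈ admissibleS s₁ 𝒞 k V) (h₂ : IsMinimiserS d s₂ 𝒞 L N k V U₂) :
    levelAction d L N k U₂ ≤ levelAction d L N k U₁ + ω := by
  obtain ⟨U', hU', hle⟩ := exists_admissibleS_le_add hL hC hE hR hV hU₁
  exact (h₂.le U' hU').trans hle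

/-- **★★ MINIMISER FORM, TWO SIDES**: with (H2) for BOTH schemes, minimisers `U₁, U₂` of the two constrained problems at the same datum `V ∈ D` have
`|A^{(k)}(U₁) − A^{(k)}(U₂)| ≤ ω` ((H1) is symmetric, §2). [folklore] -/
theorem abs_levelAction_isMinimiserS_sub_le (hE : ApproxSchemeGaugeEquiv d s₁ s₂ L N k (𝒞 k) δ)
    (hR₁ : RightInverseModulus d s₁ 𝒞 L N k D δ ω) (hR₂ : RightInverseModulus d s₂ 𝒞 L N k D δ ω)
    {V U₁ U₂ : Site d → Fin d → (Matrix n n ℂ)ˣ} (hV : V ∈ D) (h₁ : IsMinimiserS d s₁ 𝒞 L N k V U₁) (h₂ : IsMinimiserS d s₂ 𝒞 L N k V U₂) :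
    |levelAction d L N k U₁ - levelAction d L N k U₂| ≤ ω := by
  have a := levelAction_isMinimiserS_le_add hL hC hE hR₂ hV h₁.mem h₂
  have b := levelAction_isMinimiserS_le_add hL hC hE.symm hR₁ hV h₂.mem h₁
  rw [abs_le]
  constructor <;> linarith

/-- **★ INF FORM, ONE SIDE**: `inf A^{(k)}(admissibleS s₂ 𝒞 k V) ≤ inf A^{(k)}(admissibleS s₁ 𝒞 k V) + ω` for an `s₁`-admissible datum `V ∈ D`, the `s₂`-side image bounded
below.  No minimiser assumed. [folklore] -/
theorem sInf_levelAction_admissibleS_le_add (hE : ApproxSchemeGaugeEquiv d s₁ s₂ L N k (𝒞 k) δ) (hR : RightInverseModulus d s₂ 𝒞 L N k D δ ω)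
    {V : Site d → Fin d → (Matrix n n ℂ)ˣ} (hV : V ∈ D) (hne : (admissibleS s₁ 𝒞 k V).Nonempty)
    (hbdd : BddBelow (levelAction d L N k '' admissibleS s₂ 𝒞 k V)) :
    sInf (levelAction d L N k '' admissibleS s₂ 𝒞 k V) ≤ sInf (levelAction d L N k '' admissibleS s₁ 𝒞 k V) + ω := by
  rw [← sub_le_iff_le_add]
  refine le_csInf (hne.image _) ?_
  rintro _ ⟨U, hU, rfl⟩
  obtain ⟨U', hU', hle⟩ := exists_admissibleS_le_add hL hC hE hR hV hU
  have h := csInf_le hbdd (Set.mem_image_of_mem _ hU')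
  linarith

/-- **★★ INF FORM, TWO SIDES**: with (H2) for both schemes, on a class with a level-action lower bound and an `s₁`-admissible datum `V ∈ D`,
`|inf A^{(k)}(admissibleS s₁ 𝒞 k V) − inf A^{(k)}(admissibleS s₂ 𝒞 k V)| ≤ ω` — THE END NUMBERS OF THE TWO CONSTRAINED PROBLEMS AGREE TO WITHIN THE MODULUS. [folklore] -/
theorem abs_sInf_sub_sInf_le (hE : ApproxSchemeGaugeEquiv d s₁ s₂ L N k (𝒞 k) δ)
    (hR₁ : RightInverseModulus d s₁ 𝒞 L N k D δ ω) (hR₂ : RightInverseModulus d s₂ 𝒞 L N k D δ ω)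
    {V : Site d → Fin d → (Matrix n n ℂ)ˣ} (hV : V ∈ D) (hne : (admissibleS s₁ 𝒞 k V).Nonempty) (hB : BddBelow (levelAction d L N k '' 𝒞 k)) :
    |sInf (levelAction d L N k '' admissibleS s₁ 𝒞 k V) - sInf (levelAction d L N k '' admissibleS s₂ 𝒞 k V)| ≤ ω := by
  have hne₂ : (admissibleS s₂ 𝒞 k V).Nonempty := nonempty_admissibleS_of_approx hL hC hE hR₂ hV hne
  have a := sInf_levelAction_admissibleS_le_add hL hC hE hR₂ hV hne (bddBelow_levelAction_image_admissibleS hB V)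
  have b := sInf_levelAction_admissibleS_le_add hL hC hE.symm hR₁ hV hne₂ (bddBelow_levelAction_image_admissibleS hB V)
  rw [abs_le]
  constructor <;> linarith

/-- **★★ AGAINST (43)**: for a scheme `s` approximately equivalent to `step42 L` at depth `k` (defect `δ`) with right-inverse moduli `ω` for BOTH (43) and `s` on the data `D`,
on a class with a level-action lower bound, every (43)-admissible datum `V ∈ D` has `|inf A^{(k)}(admissibleS s 𝒞 k V) − minAct d 𝒞 L N k V| ≤ ω`
(`MinimalActionSandwich.minAct` = [Balaban1985Variational] (5)–(6)'s `A_k(V)`; g0's dictionary `admissibleS_step42`). [folklore] -/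
theorem abs_sInf_admissibleS_sub_minAct_le (hE : ApproxSchemeGaugeEquiv d (fun _ => step42 L) s L N k (𝒞 k) δ)
    (hR43 : RightInverseModulus d (fun _ => step42 L) 𝒞 L N k D δ ω) (hRs : RightInverseModulus d s 𝒞 L N k D δ ω)
    {V : Site d → Fin d → (Matrix n n ℂ)ˣ} (hV : V ∈ D) (hne : (admissible 𝒞 L k V).Nonempty) (hB : BddBelow (levelAction d L N k '' 𝒞 k)) :
    |sInf (levelAction d L N k '' admissibleS s 𝒞 k V) - minAct d 𝒞 L N k V| ≤ ω := by
  rw [← admissibleS_step42] at hne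
  have h := abs_sInf_sub_sInf_le hL hC hE hR43 hRs hV hne hB
  rw [admissibleS_step42] at h
  rw [abs_sub_comm]
  exact h

/-- **CONSISTENCY WITH PART 17** (`δ = 0`): under EXACT equivalence the right-inverse input is free with `ω = 0` (`rightInverseModulus_zero`) and §4 gives back the
equality of the two infima — here under admissibility + a class lower bound; part 17's `sInf_levelAction_admissibleS_eq` (hypothesis-free) is the sharper statement. [folklore] -/
theorem sInf_levelAction_admissibleS_eq_of_schemeGaugeEquiv' (hE : SchemeGaugeEquiv d s₁ s₂ L N k (𝒞 k)) {V : Site d → Fin d → (Matrix n n ℂ)ˣ}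
    (hne : (admissibleS s₁ 𝒞 k V).Nonempty) (hB : BddBelow (levelAction d L N k '' 𝒞 k)) :
    sInf (levelAction d L N k '' admissibleS s₂ 𝒞 k V) = sInf (levelAction d L N k '' admissibleS s₁ 𝒞 k V) := by
  have h := abs_sInf_sub_sInf_le (D := Set.univ) hL hC (approx_of_schemeGaugeEquiv hE le_rfl)
    (rightInverseModulus_zero le_rfl) (rightInverseModulus_zero le_rfl) (Set.mem_univ V) hne hB
  have h0 := abs_nonpos_iff.mp h
  linarith [sub_eq_zero.mp h0]

end Transfer

end

end Summit.QuantumFields.YangMills.BalabanUVNodes.N16ApproximateSchemeTransfer
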